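import Mathlib.AlgebraicGeometry.EllipticCurve.Affine.Point
import Mathlib.GroupTheory.QuotientGroup.Basic
import HarnessLib

/-!
# The complete `2`-descent map (Silverman AEC Prop. X.1.4), algebraic part

For an elliptic curve `E/F` over a field `F` of characteristic `0` whose `2`-torsion is rational,
Silverman, *The Arithmetic of Elliptic Curves*, 2nd ed., Prop. X.1.4 (Complete `2`-descent)
gives an injective homomorphism `E(F)/2E(F) → F*/(F*)² × F*/(F*)²`,
`P = (x, y) ↦ (x - e₁, x - e₂)` for `x ≠ e₁, e₂`, `T₁ = (e₁, *) ↦ ((e₁ - e₃)/(e₁ - e₂), e₁ - e₂)`,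
`T₂ = (e₂, *) ↦ (e₂ - e₁, (e₂ - e₃)/(e₂ - e₁))`, `O ↦ (1, 1)`, and states that its image lies in
`K(S, 2) × K(S, 2)` over a number field. Silverman deduces X.1.4 from the Kummer-theoretic
Thm. X.1.1; this file gives a self-contained *elementary* proof of the algebraic half:

* `WeierstrassCurve.Affine.Point.twoDescentComponent W e₁ e₂ e₃ : E(F) → Fˣ/(Fˣ)²`, the
  component at `T₁` (value `(e₁ - e₂)(e₁ - e₃) ≡ (e₁ - e₃)/(e₁ - e₂)` mod squares at `T₁`);
* `twoDescentComponent_add`: it is a homomorphism — by Mathlib's chord-and-tangent identity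
  `addPolynomial_slope` (`W(X, line) = -(X - x₁)(X - x₂)(X - x₃)`) evaluated at `X = e₁`, which
  gives `(x₁ - e₁)(x₂ - e₁)(x₃ - e₁) = □` (`mul_mul_addX_sub_eq_sq`), and the translation formula
  `(x(P + T₁) - e₁)(x(P) - e₁) = (e₁ - e₂)(e₁ - e₃)` (`addX_twoTorsion_sub_mul`);
* `exists_add_self_of_twoDescentComponent_eq_one`: a point with both components trivial is in
  `2E(F)` — by the explicit halving formula `exists_add_self_eq` (`x(Q) = x₀ + u₁u₂ + u₁u₃ + u₂u₃`
  where `uᵢ² = x₀ - eᵢ`), verified as a polynomial identity;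
* `twoDescentMap`, `ker_twoDescentMap` (`= 2E(F)`), and `finite_quotient_two_of_subset`:
  `E(F)/2E(F)` is finite once the components take values in a finite set (over a number field:
  `K(S, 2)`, in the sibling files towards the weak Mordell–Weil theorem AEC VIII.1.1).

We work with a *general* Weierstrass equation (`a₁, a₃` arbitrary) rather than Silverman's
`y² = (x - e₁)(x - e₂)(x - e₃)`: rational `2`-torsion is the hypothesis
`WeierstrassCurve.Affine.SplitTwoTorsion W e₁ e₂ e₃` that the `2`-division cubic
`4x³ + b₂x² + 2b₄x + b₆ = (2y + a₁x + a₃)²` equals `4(x - e₁)(x - e₂)(x - e₃)`; the `x`-coordinate,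
hence the descent map, is unchanged by the shear `y ↦ y + (a₁x + a₃)/2` to Silverman's form, and
Mathlib has no point-level isomorphism for `WeierstrassCurve.VariableChange`, so this avoids it.
`CharZero F` is assumed (the halving formulas divide by `2`; `ring` closes rational-coefficient
identities under `CharZero`).

## Design

* Deliberate dot-notation extensions of Mathlib's namespaces `WeierstrassCurve.Affine` and
  `WeierstrassCurve.Affine.Point`; a generic `[DecidableEq F]` as in Mathlib's group law.
* `SqUnits F = Fˣ ⧸ (powMonoidHom 2).range` and the total function `sqClass : F → SqUnits F`
  (junk value `1` at `0`) avoid dependent `Units.mk0` bookkeeping. On `SqUnits F` the unit group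
  carries two syntactically different `Monoid F` instance paths, so `mul_one`/`one_mul`/`mul_comm`
  are restated (`SqUnits.mul_one`, …) to be usable by `rw`.
* The `linear_combination` certificates were found by Gröbner-style reduction (script kept in
  the prover's session folder); each is checked by `ring`.

## References

* J. H. Silverman, *The Arithmetic of Elliptic Curves*, 2nd ed., GTM 106, Springer 2009,
  Prop. X.1.4 (Complete `2`-descent), Thm. X.1.1, Thm. VIII.1.1. [SilvermanAEC2009]
* A. W. Knapp, *Elliptic Curves*, Mathematical Notes 40, Princeton University Press 1993,
  Thm. 4.2 (the halving criterion `P ∈ 2E ⟺ x - α, x - β, x - γ` squares) and §IV.3.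
  [Knapp1993]
-/

noncomputable section

namespace WeierstrassCurve.Affine

variable {F : Type*} [Field F] {W : Affine F}

/-! ### Rational `2`-torsion -/

/-- The `2`-torsion of the Weierstrass curve `W` is rational and given by `e₁, e₂, e₃`: the
`2`-division cubic `4x³ + b₂x² + 2b₄x + b₆ = (2y + a₁x + a₃)²` splits as
`4(x - e₁)(x - e₂)(x - e₃)`, i.e. `E[2] = {O, (e₁, *), (e₂, *), (e₃, *)}` (Silverman AEC
Prop. X.1.4, hypothesis "`E[m] ⊆ E(K)`" for `m = 2`, in the coordinates of a general Weierstrass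
equation; for `y² = (x - e₁)(x - e₂)(x - e₃)` these are Silverman's `e₁, e₂, e₃`).
[cite: SilvermanAEC2009, Prop. X.1.4] -/
structure SplitTwoTorsion (W : Affine F) (e₁ e₂ e₃ : F) : Prop where
  b₂_eq : W.b₂ = -4 * (e₁ + e₂ + e₃)
  b₄_eq : W.b₄ = 2 * (e₁ * e₂ + e₁ * e₃ + e₂ * e₃)
  b₆_eq : W.b₆ = -4 * (e₁ * e₂ * e₃)

namespace SplitTwoTorsion

variable {e₁ e₂ e₃ : F}

/-- Rational `2`-torsion is symmetric in `e₁, e₂`. [folklore] -/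
lemma swap₁₂ (h : W.SplitTwoTorsion e₁ e₂ e₃) : W.SplitTwoTorsion e₂ e₁ e₃ :=
  ⟨by rw [h.b₂_eq]; ring, by rw [h.b₄_eq]; ring, by rw [h.b₆_eq]; ring⟩

/-- Rational `2`-torsion is symmetric in `e₂, e₃`. [folklore] -/
lemma swap₂₃ (h : W.SplitTwoTorsion e₁ e₂ e₃) : W.SplitTwoTorsion e₁ e₃ e₂ :=
  ⟨by rw [h.b₂_eq]; ring, by rw [h.b₄_eq]; ring, by rw [h.b₆_eq]; ring⟩

/-- `a₁² + 4a₂ = b₂ = -4(e₁ + e₂ + e₃)`. [folklore] -/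
lemma a₂_eq (h : W.SplitTwoTorsion e₁ e₂ e₃) :
    W.a₁ ^ 2 + 4 * W.a₂ = -4 * (e₁ + e₂ + e₃) := by
  rw [← h.b₂_eq, b₂]

/-- `2a₄ + a₁a₃ = b₄ = 2(e₁e₂ + e₁e₃ + e₂e₃)`. [folklore] -/
lemma a₄_eq (h : W.SplitTwoTorsion e₁ e₂ e₃) :
    2 * W.a₄ + W.a₁ * W.a₃ = 2 * (e₁ * e₂ + e₁ * e₃ + e₂ * e₃) := by
  rw [← h.b₄_eq, b₄]

/-- `a₃² + 4a₆ = b₆ = -4e₁e₂e₃`. [folklore] -/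
lemma a₆_eq (h : W.SplitTwoTorsion e₁ e₂ e₃) :
    W.a₃ ^ 2 + 4 * W.a₆ = -4 * (e₁ * e₂ * e₃) := by
  rw [← h.b₆_eq, b₆]

/-- With rational `2`-torsion `e₁, e₂, e₃`, `Δ = 16 (e₁ - e₂)² (e₁ - e₃)² (e₂ - e₃)²`
(Silverman AEC III.1, `Δ = 16 disc(x³ + (b₂/4)x² + (b₄/2)x + b₆/4)`). [folklore] -/
lemma Δ_eq (h : W.SplitTwoTorsion e₁ e₂ e₃) :
    W.Δ = 16 * ((e₁ - e₂) * (e₁ - e₃) * (e₂ - e₃)) ^ 2 := by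
  have hb := W.b_relation
  rw [Δ, h.b₂_eq, h.b₄_eq, h.b₆_eq] at *
  linear_combination
    (- 4 * e₁ ^ 2 - 8 * e₁ * e₂ - 8 * e₁ * e₃ - 4 * e₂ ^ 2 - 8 * e₂ * e₃ - 4 * e₃ ^ 2) * hb

variable [W.IsElliptic]

/-- On an elliptic curve (`Δ ≠ 0`) the `2`-torsion abscissae are distinct: `e₁ ≠ e₂`. [folklore] -/
lemma ne₁₂ (h : W.SplitTwoTorsion e₁ e₂ e₃) : e₁ ≠ e₂ := by
  intro he
  apply W.Δ'.ne_zero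
  rw [coe_Δ', h.Δ_eq, he, sub_self, zero_mul, zero_mul, zero_pow two_ne_zero, mul_zero]

/-- On an elliptic curve the `2`-torsion abscissae are distinct: `e₁ ≠ e₃`. [folklore] -/
lemma ne₁₃ (h : W.SplitTwoTorsion e₁ e₂ e₃) : e₁ ≠ e₃ := h.swap₂₃.ne₁₂

/-- On an elliptic curve the `2`-torsion abscissae are distinct: `e₂ ≠ e₃`. [folklore] -/
lemma ne₂₃ (h : W.SplitTwoTorsion e₁ e₂ e₃) : e₂ ≠ e₃ := h.swap₁₂.ne₁₃

/-- `(e₁ - e₂)(e₁ - e₃) ≠ 0`, the value of the descent map at `T₁`. [folklore] -/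
lemma c_ne_zero (h : W.SplitTwoTorsion e₁ e₂ e₃) : (e₁ - e₂) * (e₁ - e₃) ≠ 0 :=
  mul_ne_zero (sub_ne_zero.mpr h.ne₁₂) (sub_ne_zero.mpr h.ne₁₃)

end SplitTwoTorsion

/-! ### The `2`-torsion points `Tᵢ = (eᵢ, -(a₁eᵢ + a₃)/2)` -/

variable (W) in
/-- The `y`-coordinate `-(a₁ e + a₃)/2` of the `2`-torsion point with `x`-coordinate `e`
(the solution of `2y + a₁x + a₃ = 0`; Silverman AEC III.2.3, `[2]P = O ⟺ ψ₂ = 0`). [folklore] -/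
def twoTorsionY (e : F) : F := -(W.a₁ * e + W.a₃) / 2

/-- `T = (e, -(a₁e + a₃)/2)` satisfies `-T = T` (it is the fixed point of `y ↦ -y - a₁x - a₃`).
[folklore] -/
lemma negY_twoTorsionY [CharZero F] (e : F) : W.negY e (W.twoTorsionY e) = W.twoTorsionY e := by
  simp only [negY, twoTorsionY]
  ring

variable {e₁ e₂ e₃ : F}

/-- The `2`-torsion point `T₁ = (e₁, -(a₁e₁ + a₃)/2)` lies on the curve. [folklore] -/
lemma equation_twoTorsion [CharZero F] (h : W.SplitTwoTorsion e₁ e₂ e₃) :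
    W.Equation e₁ (W.twoTorsionY e₁) := by
  have hb2 := h.a₂_eq
  have hb4 := h.a₄_eq
  have hb6 := h.a₆_eq
  rw [equation_iff, twoTorsionY]
  linear_combination (- (1 / 4 : F) * e₁ ^ 2) * hb2 + (- (1 / 2 : F) * e₁) * hb4
    + (- (1 / 4 : F)) * hb6

/-- The `2`-torsion point `T₁` is a nonsingular point of the elliptic curve. [folklore] -/
lemma nonsingular_twoTorsion [CharZero F] [W.IsElliptic] (h : W.SplitTwoTorsion e₁ e₂ e₃) :
    W.Nonsingular e₁ (W.twoTorsionY e₁) :=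
  equation_iff_nonsingular.mp (equation_twoTorsion h)


/-! ### The group `Fˣ/(Fˣ)²` and square classes -/

variable (F) in
/-- The group `Fˣ / (Fˣ)²` of non-zero elements modulo squares (the target `K*/(K*)²` of the
`2`-descent map, Silverman AEC Prop. X.1.4). [folklore] -/
abbrev SqUnits : Type _ := Fˣ ⧸ (powMonoidHom 2 : Fˣ →* Fˣ).range

namespace SqUnits

/-- `Fˣ/(Fˣ)²` has exponent `2`. [folklore] -/
lemma mul_self (g : SqUnits F) : g * g = 1 := by
  induction g using QuotientGroup.induction_on with
  | H u =>
    rw [← QuotientGroup.mk_mul, QuotientGroup.eq_one_iff]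
    exact ⟨u, by rw [powMonoidHom_apply, pow_two]⟩

/-- In `Fˣ/(Fˣ)²` every element is its own inverse. [folklore] -/
lemma inv_eq_self (g : SqUnits F) : g⁻¹ = g :=
  inv_eq_of_mul_eq_one_left (mul_self g)

/-- In `Fˣ/(Fˣ)²`, `ab = c` gives `a = cb`. [folklore] -/
lemma eq_mul_of_mul_eq {a b c : SqUnits F} (h : a * b = c) : a = c * b := by
  rw [← h, mul_assoc, mul_self]
  exact (mul_one a).symm

/-! The unit group `Fˣ` carries two syntactically different `Monoid F` instance paths, so generic
`mul_one`/`one_mul` do not fire under `rw`/`simp` on `SqUnits F`; we restate them. -/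

/-- `a · 1 = a` on `Fˣ/(Fˣ)²`, restated for `rw`. [folklore] -/
protected lemma mul_one (a : SqUnits F) : a * 1 = a := mul_one a

/-- `1 · a = a` on `Fˣ/(Fˣ)²`, restated for `rw`. [folklore] -/
protected lemma one_mul (a : SqUnits F) : 1 * a = a := one_mul a

/-- Commutativity on `Fˣ/(Fˣ)²`, restated for `exact`. [folklore] -/
protected lemma mul_comm (a b : SqUnits F) : a * b = b * a := mul_comm a b

end SqUnits

/-- The square class `a (Fˣ)² ∈ Fˣ/(Fˣ)²` of `a : F`, with junk value `1` at `a = 0`.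
[folklore] -/
def sqClass (a : F) : SqUnits F :=
  open scoped Classical in
  if h : a = 0 then 1 else QuotientGroup.mk (Units.mk0 a h)

open scoped Classical in
/-- The square class of `a ≠ 0` is the class of the unit `a`. [folklore] -/
lemma sqClass_of_ne_zero {a : F} (h : a ≠ 0) :
    sqClass a = QuotientGroup.mk (Units.mk0 a h) := by
  rw [sqClass, dif_neg h]

open scoped Classical in
/-- Junk value: the square class of `0` is `1`. [folklore] -/
@[simp] lemma sqClass_zero : sqClass (0 : F) = 1 := by rw [sqClass, dif_pos rfl]

/-- The square class is multiplicative on non-zero elements. [folklore] -/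
lemma sqClass_mul {a b : F} (ha : a ≠ 0) (hb : b ≠ 0) :
    sqClass (a * b) = sqClass a * sqClass b := by
  rw [sqClass_of_ne_zero ha, sqClass_of_ne_zero hb, sqClass_of_ne_zero (mul_ne_zero ha hb),
    ← QuotientGroup.mk_mul, Units.mk0_mul]

/-- `a·a` has trivial square class. [folklore] -/
lemma sqClass_mul_self (a : F) : sqClass (a * a) = 1 := by
  by_cases ha : a = 0
  · rw [ha, mul_zero, sqClass_zero]
  · rw [sqClass_mul ha ha, SqUnits.mul_self]

/-- `a²` has trivial square class. [folklore] -/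
lemma sqClass_sq (a : F) : sqClass (a ^ 2) = 1 := by rw [pow_two, sqClass_mul_self]

/-- `a ≠ 0` has trivial square class iff it is a square. [folklore] -/
lemma sqClass_eq_one_iff {a : F} (ha : a ≠ 0) : sqClass a = 1 ↔ ∃ u : F, a = u ^ 2 := by
  rw [sqClass_of_ne_zero ha, QuotientGroup.eq_one_iff]
  constructor
  · rintro ⟨u, hu⟩
    refine ⟨u, ?_⟩
    rw [powMonoidHom_apply, Units.ext_iff, Units.val_pow_eq_pow_val, Units.val_mk0] at hu
    exact hu.symm
  · rintro ⟨u, hu⟩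
    have hu0 : u ≠ 0 := by rintro rfl; exact ha (by rw [hu, zero_pow two_ne_zero])
    exact ⟨Units.mk0 u hu0, by
      rw [powMonoidHom_apply, Units.ext_iff, Units.val_pow_eq_pow_val, Units.val_mk0,
        Units.val_mk0, hu]⟩

/-- Three non-zero elements with square product: the class of the third is the product of the
classes of the first two. [folklore] -/
lemma sqClass_eq_mul_of_mul_mul_eq_sq {a b c z : F} (ha : a ≠ 0) (hb : b ≠ 0) (hc : c ≠ 0)
    (h : a * b * c = z ^ 2) : sqClass c = sqClass a * sqClass b := by
  have h1 : sqClass a * sqClass b * sqClass c = 1 := by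
    rw [← sqClass_mul ha hb, ← sqClass_mul (mul_ne_zero ha hb) hc, h, sqClass_sq]
  calc sqClass c = 1 * sqClass c := (SqUnits.one_mul _).symm
    _ = (sqClass a * sqClass b) * (sqClass a * sqClass b) * sqClass c := by rw [SqUnits.mul_self]
    _ = (sqClass a * sqClass b) * (sqClass a * sqClass b * sqClass c) := by rw [mul_assoc]
    _ = sqClass a * sqClass b := by rw [h1, SqUnits.mul_one]

/-! ### The `2`-descent map -/

section eval

omit [Field F] in
/-- The polynomial `addPolynomial x₁ y₁ ℓ` (the Weierstrass equation restricted to the line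
`Y = ℓ(X - x₁) + y₁`) evaluated at `X = e`. [folklore] -/
lemma eval_addPolynomial {R : Type*} [CommRing R] {W : Affine R} (x₁ y₁ ℓ e : R) :
    (W.addPolynomial x₁ y₁ ℓ).eval e =
      (ℓ * (e - x₁) + y₁) ^ 2 + W.a₁ * e * (ℓ * (e - x₁) + y₁) + W.a₃ * (ℓ * (e - x₁) + y₁)
        - (e ^ 3 + W.a₂ * e ^ 2 + W.a₄ * e + W.a₆) := by
  rw [addPolynomial_eq, Cubic.toPoly]
  simp only [Polynomial.eval_neg, Polynomial.eval_add, Polynomial.eval_mul, Polynomial.eval_C,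
    Polynomial.eval_pow, Polynomial.eval_X]
  ring

end eval

variable [DecidableEq F]

/-- **The chord-and-tangent identity behind the `2`-descent** (Silverman AEC X.1, proof of
Prop. X.1.4 via Thm. X.1.1; classical): if `T = (e, y_T)` is a rational `2`-torsion point and
`P₁ = (x₁, y₁)`, `P₂ = (x₂, y₂)`, `P₁ + P₂ = (x₃, *)`, then
`(x₁ - e)(x₂ - e)(x₃ - e) = (ℓ(e - x₁) + y₁ - y_T)²` is a square, where `ℓ` is the slope of the
chord (tangent if `P₁ = P₂`). It is Mathlib's `addPolynomial_slope`
(`W(X, ℓ(X - x₁) + y₁) = -(X - x₁)(X - x₂)(X - x₃)`) evaluated at `X = e`. [folklore] -/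
lemma mul_mul_addX_sub_eq_sq [CharZero F] (h : W.SplitTwoTorsion e₁ e₂ e₃) {x₁ x₂ y₁ y₂ : F}
    (h₁ : W.Nonsingular x₁ y₁) (h₂ : W.Nonsingular x₂ y₂) (hxy : ¬(x₁ = x₂ ∧ y₁ = W.negY x₂ y₂)) :
    (x₁ - e₁) * (x₂ - e₁) * (W.addX x₁ x₂ (W.slope x₁ x₂ y₁ y₂) - e₁) =
      (W.slope x₁ x₂ y₁ y₂ * (e₁ - x₁) + y₁ - W.twoTorsionY e₁) ^ 2 := by
  have hp := congrArg (Polynomial.eval e₁) (addPolynomial_slope h₁.1 h₂.1 hxy)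
  rw [eval_addPolynomial] at hp
  simp only [Polynomial.eval_neg, Polynomial.eval_mul, Polynomial.eval_sub, Polynomial.eval_X,
    Polynomial.eval_C] at hp
  have hT := equation_twoTorsion h
  rw [equation_iff] at hT
  have hn := negY_twoTorsionY (W := W) e₁
  rw [negY] at hn
  linear_combination -hp + hT
    - (W.slope x₁ x₂ y₁ y₂ * (e₁ - x₁) + y₁ - W.twoTorsionY e₁) * hn

omit [DecidableEq F] in
/-- Clearing the denominator in `addX`: `d² x₃ = n² + a₁nd - (a₂ + x₁ + x₂)d²` for `ℓ = n/d`
(local copy of `HeightsProofs.sq_mul_addX_div`, to keep imports light). [folklore] -/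
private lemma sq_mul_addX_div' (x₁ x₂ n d : F) (hd : d ≠ 0) :
    d ^ 2 * W.addX x₁ x₂ (n / d) = n ^ 2 + W.a₁ * n * d - (W.a₂ + x₁ + x₂) * d ^ 2 := by
  simp only [addX]
  field_simp
  ring

/-- **Translation by a `2`-torsion point** (classical; e.g. the formula
`x(P + T) - e = (e - e')(e - e'')/(x(P) - e)` for `y² = (x - e)(x - e')(x - e'')`):
for `P = (x₁, y₁)` with `x₁ ≠ e₁`, `(x(P + T₁) - e₁)(x₁ - e₁) = (e₁ - e₂)(e₁ - e₃)`. [folklore] -/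
lemma addX_twoTorsion_sub_mul [CharZero F] (h : W.SplitTwoTorsion e₁ e₂ e₃) {x₁ y₁ : F}
    (h₁ : W.Nonsingular x₁ y₁) (hx : x₁ ≠ e₁) :
    (W.addX x₁ e₁ (W.slope x₁ e₁ y₁ (W.twoTorsionY e₁)) - e₁) * (x₁ - e₁) =
      (e₁ - e₂) * (e₁ - e₃) := by
  have hd : x₁ - e₁ ≠ 0 := sub_ne_zero.mpr hx
  have key := sq_mul_addX_div' (W := W) x₁ e₁ (y₁ - W.twoTorsionY e₁) (x₁ - e₁) hd
  have hb2 := h.a₂_eq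
  have hb4 := h.a₄_eq
  have hb6 := h.a₆_eq
  have hE := h₁.1
  rw [equation_iff] at hE
  rw [slope_of_X_ne hx]
  rw [twoTorsionY] at key ⊢
  refine mul_left_injective₀ hd ?_
  dsimp only
  linear_combination key + hE + ((1 / 2 : F) * x₁ * e₁ - (1 / 4 : F) * e₁ ^ 2) * hb2
    + ((1 / 2 : F) * x₁) * hb4 + ((1 / 4 : F)) * hb6

omit [DecidableEq F] in
/-- A point with the `x`-coordinate of a `2`-torsion point is that `2`-torsion point. [folklore] -/
lemma eq_twoTorsionY_of_eq [CharZero F] (h : W.SplitTwoTorsion e₁ e₂ e₃) {y₁ : F}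
    (h₁ : W.Nonsingular e₁ y₁) : y₁ = W.twoTorsionY e₁ := by
  rcases Y_eq_of_X_eq h₁.1 (equation_twoTorsion h) rfl with hy | hy
  · exact hy
  · rwa [negY_twoTorsionY] at hy

namespace Point

variable (W e₁ e₂ e₃) in
omit [DecidableEq F] in
/-- One component of the complete `2`-descent map `E(F) → Fˣ/(Fˣ)²` attached to the rational
`2`-torsion point `T₁ = (e₁, *)` (Silverman AEC Prop. X.1.4): `P = (x, y) ↦ x - e₁` for
`x ≠ e₁`, `T₁ ↦ (e₁ - e₂)(e₁ - e₃)` (Silverman's `(e₁ - e₃)/(e₁ - e₂)`, the same class modulo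
squares; forced by `(x - e₁)(x - e₂)(x - e₃) ≡ 1`), `O ↦ 1`.
[cite: SilvermanAEC2009, Prop. X.1.4] -/
def twoDescentComponent : W.Point → SqUnits F
  | 0 => 1
  | some x _ _ => if x = e₁ then sqClass ((e₁ - e₂) * (e₁ - e₃)) else sqClass (x - e₁)

/-- The descent component of `O` is `1`. [cite: SilvermanAEC2009, Prop. X.1.4] -/
@[simp] lemma twoDescentComponent_zero :
    twoDescentComponent W e₁ e₂ e₃ 0 = 1 := rfl

/-- The descent component at `T₁` of a point with `x = e₁` is `(e₁ - e₂)(e₁ - e₃)`.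
[cite: SilvermanAEC2009, Prop. X.1.4] -/
lemma twoDescentComponent_some_of_eq {x y : F} (hP : W.Nonsingular x y) (hx : x = e₁) :
    twoDescentComponent W e₁ e₂ e₃ (some x y hP) = sqClass ((e₁ - e₂) * (e₁ - e₃)) := by
  rw [twoDescentComponent, if_pos hx]

/-- The descent component at `T₁` of `(x, y)` with `x ≠ e₁` is `x - e₁`.
[cite: SilvermanAEC2009, Prop. X.1.4] -/
lemma twoDescentComponent_some_of_ne {x y : F} (hP : W.Nonsingular x y) (hx : x ≠ e₁) :
    twoDescentComponent W e₁ e₂ e₃ (some x y hP) = sqClass (x - e₁) := by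
  rw [twoDescentComponent, if_neg hx]

/-- The descent component is even, `δ(-P) = δ(P)` (it only depends on `x`). [folklore] -/
lemma twoDescentComponent_neg (P : W.Point) :
    twoDescentComponent W e₁ e₂ e₃ (-P) = twoDescentComponent W e₁ e₂ e₃ P := by
  rcases P with _ | ⟨x, y, hP⟩
  · rfl
  · rw [neg_some]
    by_cases hx : x = e₁
    · rw [twoDescentComponent_some_of_eq _ hx, twoDescentComponent_some_of_eq _ hx]
    · rw [twoDescentComponent_some_of_ne _ hx, twoDescentComponent_some_of_ne _ hx]

variable [CharZero F] [W.IsElliptic]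

/-- `T₁ + Q` for `Q = (x₂, y₂)`, `x₂ ≠ e₁`. [folklore] -/
private lemma twoDescentComponent_twoTorsion_add (h : W.SplitTwoTorsion e₁ e₂ e₃) {x₂ y₂ : F}
    (h₂ : W.Nonsingular x₂ y₂) (hx₂ : x₂ ≠ e₁) :
    twoDescentComponent W e₁ e₂ e₃ (some x₂ y₂ h₂ + some e₁ _ (nonsingular_twoTorsion h)) =
      sqClass ((e₁ - e₂) * (e₁ - e₃)) * sqClass (x₂ - e₁) := by
  have key := addX_twoTorsion_sub_mul h h₂ hx₂
  rw [add_of_X_ne hx₂]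
  have hx₃ : W.addX x₂ e₁ (W.slope x₂ e₁ y₂ (W.twoTorsionY e₁)) - e₁ ≠ 0 := by
    intro h0
    rw [h0, zero_mul] at key
    exact h.c_ne_zero key.symm
  rw [twoDescentComponent_some_of_ne _ (sub_ne_zero.mp hx₃)]
  apply SqUnits.eq_mul_of_mul_eq
  rw [← sqClass_mul hx₃ (sub_ne_zero.mpr hx₂), key]

/-- **The `2`-descent component is a homomorphism** `E(F) → Fˣ/(Fˣ)²`
(Silverman AEC Prop. X.1.4; here by the chord-and-tangent identity `mul_mul_addX_sub_eq_sq`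
and the translation formula `addX_twoTorsion_sub_mul`). [cite: SilvermanAEC2009, Prop. X.1.4] -/
theorem twoDescentComponent_add (h : W.SplitTwoTorsion e₁ e₂ e₃) (P Q : W.Point) :
    twoDescentComponent W e₁ e₂ e₃ (P + Q) =
      twoDescentComponent W e₁ e₂ e₃ P * twoDescentComponent W e₁ e₂ e₃ Q := by
  rcases P with _ | ⟨x₁, y₁, h₁⟩
  · rw [← zero_def, zero_add, twoDescentComponent_zero, SqUnits.one_mul]
  rcases Q with _ | ⟨x₂, y₂, h₂⟩
  · rw [← zero_def, add_zero, twoDescentComponent_zero, SqUnits.mul_one]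
  have hc := h.c_ne_zero
  by_cases hx₁ : x₁ = e₁
  · subst hx₁
    obtain rfl := eq_twoTorsionY_of_eq h h₁
    rw [twoDescentComponent_some_of_eq _ rfl]
    by_cases hx₂ : x₂ = x₁
    · subst hx₂
      obtain rfl := eq_twoTorsionY_of_eq h h₂
      rw [twoDescentComponent_some_of_eq _ rfl, add_self_of_Y_eq (negY_twoTorsionY _).symm,
        twoDescentComponent_zero]
      exact (SqUnits.mul_self _).symm
    · rw [add_comm, twoDescentComponent_twoTorsion_add h h₂ hx₂,
        twoDescentComponent_some_of_ne _ hx₂]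
  by_cases hx₂ : x₂ = e₁
  · subst hx₂
    obtain rfl := eq_twoTorsionY_of_eq h h₂
    rw [twoDescentComponent_twoTorsion_add h h₁ hx₁, twoDescentComponent_some_of_ne _ hx₁,
      twoDescentComponent_some_of_eq _ rfl]
    exact SqUnits.mul_comm _ _
  rw [twoDescentComponent_some_of_ne _ hx₁, twoDescentComponent_some_of_ne _ hx₂]
  by_cases hxy : x₁ = x₂ ∧ y₁ = W.negY x₂ y₂
  · rw [add_of_Y_eq hxy.1 hxy.2, twoDescentComponent_zero, hxy.1, ← sqClass_mul
      (sub_ne_zero.mpr hx₂) (sub_ne_zero.mpr hx₂), sqClass_mul_self]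
  rw [add_some hxy]
  by_cases hx₃ : W.addX x₁ x₂ (W.slope x₁ x₂ y₁ y₂) = e₁
  · -- `P + Q = T₁`, so `Q = -P + T₁`
    rw [twoDescentComponent_some_of_eq _ hx₃]
    have hPQ : some x₁ y₁ h₁ + some x₂ y₂ h₂ = some e₁ _ (nonsingular_twoTorsion h) := by
      rw [add_some hxy]
      simp only [some.injEq]
      exact ⟨hx₃, eq_twoTorsionY_of_eq h (hx₃ ▸ nonsingular_add h₁ h₂ hxy)⟩
    have hQ : some x₂ y₂ h₂ = -some x₁ y₁ h₁ + some e₁ _ (nonsingular_twoTorsion h) :=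
      eq_neg_add_iff_add_eq.mpr hPQ
    rw [neg_some, add_of_X_ne hx₁, some.injEq] at hQ
    have key := addX_twoTorsion_sub_mul h ((nonsingular_neg ..).mpr h₁) hx₁
    rw [← hQ.1] at key
    rw [← sqClass_mul (sub_ne_zero.mpr hx₁) (sub_ne_zero.mpr hx₂),
      show (x₁ - e₁) * (x₂ - e₁) = (e₁ - e₂) * (e₁ - e₃) by rw [mul_comm]; exact key]
  · rw [twoDescentComponent_some_of_ne _ hx₃]
    exact sqClass_eq_mul_of_mul_mul_eq_sq (sub_ne_zero.mpr hx₁) (sub_ne_zero.mpr hx₂)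
      (sub_ne_zero.mpr hx₃) (mul_mul_addX_sub_eq_sq h h₁ h₂ hxy)


/-! ### The kernel of the `2`-descent map: explicit halving -/

/-- **Halving a point** (the classical criterion "`P ∈ 2E(F)` iff `x(P) - eᵢ` are all squares",
Knapp, *Elliptic Curves*, Thm. 4.2, constructive direction, here for a general Weierstrass
equation): if `x₀ - eᵢ = uᵢ²` (`i = 1, 2, 3`) with the signs normalised by
`y₀ + (a₁x₀ + a₃)/2 = u₁u₂u₃`, then `Q = (x₁, y₁)` with `x₁ = x₀ + u₁u₂ + u₁u₃ + u₂u₃`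
(so `x₁ - eᵢ = (uᵢ + uⱼ)(uᵢ + uₖ)`) and `y₁ + (a₁x₁ + a₃)/2 = (u₁ + u₂)(u₁ + u₃)(u₂ + u₃)`
satisfies `2Q = P`; the verification is a polynomial identity. [cite: Knapp1993, Thm. 4.2] -/
theorem exists_add_self_eq (h : W.SplitTwoTorsion e₁ e₂ e₃) {x₀ y₀ u₁ u₂ u₃ : F}
    (h₀ : W.Nonsingular x₀ y₀) (hu₁ : x₀ - e₁ = u₁ ^ 2) (hu₂ : x₀ - e₂ = u₂ ^ 2)
    (hu₃ : x₀ - e₃ = u₃ ^ 2) (hy₀ : y₀ + (W.a₁ * x₀ + W.a₃) / 2 = u₁ * u₂ * u₃) :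
    ∃ Q : W.Point, Q + Q = some x₀ y₀ h₀ := by
  -- the hypotheses on the coefficients, with `eᵢ = x₀ - uᵢ²` substituted
  have hb2' : W.a₁ ^ 2 + 4 * W.a₂ = -4 * ((x₀ - u₁ ^ 2) + (x₀ - u₂ ^ 2) + (x₀ - u₃ ^ 2)) := by
    rw [h.a₂_eq, ← hu₁, ← hu₂, ← hu₃]; ring
  have hb4' : 2 * W.a₄ + W.a₁ * W.a₃ = 2 * ((x₀ - u₁ ^ 2) * (x₀ - u₂ ^ 2)
      + (x₀ - u₁ ^ 2) * (x₀ - u₃ ^ 2) + (x₀ - u₂ ^ 2) * (x₀ - u₃ ^ 2)) := by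
    rw [h.a₄_eq, ← hu₁, ← hu₂, ← hu₃]; ring
  have hb6' : W.a₃ ^ 2 + 4 * W.a₆ = -4 * ((x₀ - u₁ ^ 2) * (x₀ - u₂ ^ 2) * (x₀ - u₃ ^ 2)) := by
    rw [h.a₆_eq, ← hu₁, ← hu₂, ← hu₃]; ring
  -- `y₁ + (a₁x₁ + a₃)/2 ≠ 0`
  have hne : (u₁ + u₂) * (u₁ + u₃) * (u₂ + u₃) ≠ 0 := by
    have key : ∀ {u v e e' : F}, x₀ - e = u ^ 2 → x₀ - e' = v ^ 2 → e ≠ e' → u + v ≠ 0 := by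
      intro u v e e' hu hv hee huv
      apply hee
      rw [eq_neg_of_add_eq_zero_left huv] at hu
      linear_combination hv - hu
    exact mul_ne_zero (mul_ne_zero (key hu₁ hu₂ h.ne₁₂) (key hu₁ hu₃ h.ne₁₃)) (key hu₂ hu₃ h.ne₂₃)
  set x₁ := x₀ + u₁ * u₂ + u₁ * u₃ + u₂ * u₃ with hx₁
  set y₁ := (u₁ + u₂) * (u₁ + u₃) * (u₂ + u₃) - (W.a₁ * x₁ + W.a₃) / 2 with hy₁
  have hQ : W.Equation x₁ y₁ := by
    rw [equation_iff, hy₁, hx₁]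
    linear_combination (- (1 / 4 : F) * u₁ ^ 2 * u₂ ^ 2 - (1 / 2 : F) * u₁ ^ 2 * u₂ * u₃
      - (1 / 4 : F) * u₁ ^ 2 * u₃ ^ 2 - (1 / 2 : F) * u₁ * u₂ ^ 2 * u₃
      - (1 / 2 : F) * u₁ * u₂ * u₃ ^ 2 - (1 / 4 : F) * u₂ ^ 2 * u₃ ^ 2 - (1 / 2 : F) * x₀ * u₁ * u₂
      - (1 / 2 : F) * x₀ * u₁ * u₃ - (1 / 2 : F) * x₀ * u₂ * u₃ - (1 / 4 : F) * x₀ ^ 2) * hb2'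
      + (- (1 / 2 : F) * u₁ * u₂ - (1 / 2 : F) * u₁ * u₃ - (1 / 2 : F) * u₂ * u₃
      - (1 / 2 : F) * x₀) * hb4' + (- (1 / 4 : F)) * hb6'
  have hQn : W.Nonsingular x₁ y₁ := equation_iff_nonsingular.mp hQ
  have hy : y₁ ≠ W.negY x₁ y₁ := by
    intro hyy
    apply hne
    rw [negY, hy₁] at hyy
    linear_combination (1 / 2 : F) * hyy
  have hD : y₁ - W.negY x₁ y₁ ≠ 0 := sub_ne_zero.mpr hy
  refine ⟨some x₁ y₁ hQn, ?_⟩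
  rw [add_self_of_Y_ne hy]
  have hX : W.addX x₁ x₁ (W.slope x₁ x₁ y₁ y₁) = x₀ := by
    have key := sq_mul_addX_div' (W := W) x₁ x₁ (3 * x₁ ^ 2 + 2 * W.a₂ * x₁ + W.a₄ - W.a₁ * y₁)
      _ hD
    rw [slope_of_Y_ne rfl hy]
    refine mul_left_cancel₀ (pow_ne_zero 2 hD) ?_
    rw [key, negY, hy₁, hx₁]
    linear_combination (u₁ ^ 3 * u₂ ^ 3 + 5 * u₁ ^ 3 * u₂ ^ 2 * u₃ + 5 * u₁ ^ 3 * u₂ * u₃ ^ 2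
      + u₁ ^ 3 * u₃ ^ 3 + 5 * u₁ ^ 2 * u₂ ^ 3 * u₃ + 11 * u₁ ^ 2 * u₂ ^ 2 * u₃ ^ 2
      + (1 / 4 : F) * u₁ ^ 2 * u₂ ^ 2 * W.a₁ ^ 2 + 5 * u₁ ^ 2 * u₂ * u₃ ^ 3
      + (1 / 2 : F) * u₁ ^ 2 * u₂ * u₃ * W.a₁ ^ 2 + (1 / 4 : F) * u₁ ^ 2 * u₃ ^ 2 * W.a₁ ^ 2
      + 5 * u₁ * u₂ ^ 3 * u₃ ^ 2 + 5 * u₁ * u₂ ^ 2 * u₃ ^ 3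
      + (1 / 2 : F) * u₁ * u₂ ^ 2 * u₃ * W.a₁ ^ 2 + (1 / 2 : F) * u₁ * u₂ * u₃ ^ 2 * W.a₁ ^ 2
      + u₂ ^ 3 * u₃ ^ 3 + (1 / 4 : F) * u₂ ^ 2 * u₃ ^ 2 * W.a₁ ^ 2 + 2 * x₀ * u₁ ^ 3 * u₂
      + 2 * x₀ * u₁ ^ 3 * u₃ + 6 * x₀ * u₁ ^ 2 * u₂ ^ 2 + 14 * x₀ * u₁ ^ 2 * u₂ * u₃
      + 6 * x₀ * u₁ ^ 2 * u₃ ^ 2 + 2 * x₀ * u₁ * u₂ ^ 3 + 14 * x₀ * u₁ * u₂ ^ 2 * u₃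
      + 14 * x₀ * u₁ * u₂ * u₃ ^ 2 + (1 / 2 : F) * x₀ * u₁ * u₂ * W.a₁ ^ 2 + 2 * x₀ * u₁ * u₃ ^ 3
      + (1 / 2 : F) * x₀ * u₁ * u₃ * W.a₁ ^ 2 + 2 * x₀ * u₂ ^ 3 * u₃ + 6 * x₀ * u₂ ^ 2 * u₃ ^ 2
      + 2 * x₀ * u₂ * u₃ ^ 3 + (1 / 2 : F) * x₀ * u₂ * u₃ * W.a₁ ^ 2 + u₁ ^ 2 * u₂ ^ 2 * W.a₂
      + 2 * u₁ ^ 2 * u₂ * u₃ * W.a₂ + u₁ ^ 2 * u₃ ^ 2 * W.a₂ + 2 * u₁ * u₂ ^ 2 * u₃ * W.a₂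
      + 2 * u₁ * u₂ * u₃ ^ 2 * W.a₂ + u₂ ^ 2 * u₃ ^ 2 * W.a₂ + x₀ ^ 2 * u₁ ^ 2
      + 3 * x₀ ^ 2 * u₁ * u₂ + 3 * x₀ ^ 2 * u₁ * u₃ + x₀ ^ 2 * u₂ ^ 2 + 3 * x₀ ^ 2 * u₂ * u₃
      + x₀ ^ 2 * u₃ ^ 2 + (1 / 4 : F) * x₀ ^ 2 * W.a₁ ^ 2 + 2 * x₀ * u₁ * u₂ * W.a₂
      + 2 * x₀ * u₁ * u₃ * W.a₂ + 2 * x₀ * u₂ * u₃ * W.a₂ + (1 / 2 : F) * u₁ * u₂ * W.a₁ * W.a₃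
      + (1 / 2 : F) * u₁ * u₃ * W.a₁ * W.a₃ + (1 / 2 : F) * u₂ * u₃ * W.a₁ * W.a₃
      + x₀ ^ 2 * W.a₂ + (1 / 2 : F) * x₀ * W.a₁ * W.a₃ + u₁ * u₂ * W.a₄ + u₁ * u₃ * W.a₄
      + u₂ * u₃ * W.a₄ + x₀ * W.a₄) * hb2'
      + (2 * u₁ ^ 3 * u₂ + 2 * u₁ ^ 3 * u₃ + (7 / 2 : F) * u₁ ^ 2 * u₂ ^ 2
      + 8 * u₁ ^ 2 * u₂ * u₃ + (7 / 2 : F) * u₁ ^ 2 * u₃ ^ 2 + 2 * u₁ * u₂ ^ 3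
      + 8 * u₁ * u₂ ^ 2 * u₃ + 8 * u₁ * u₂ * u₃ ^ 2 + 2 * u₁ * u₃ ^ 3 + 2 * u₂ ^ 3 * u₃
      + (7 / 2 : F) * u₂ ^ 2 * u₃ ^ 2 + 2 * u₂ * u₃ ^ 3 + x₀ * u₁ ^ 2 + x₀ * u₂ ^ 2 + x₀ * u₃ ^ 2
      - (3 / 2 : F) * x₀ ^ 2 + (1 / 4 : F) * W.a₁ * W.a₃ + (1 / 2 : F) * W.a₄) * hb4'
  have hY : W.addY x₁ x₁ y₁ (W.slope x₁ x₁ y₁ y₁) = y₀ := by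
    rw [addY, negAddY, negY, hX, slope_of_Y_ne rfl hy]
    have hl := div_mul_cancel₀ (3 * x₁ ^ 2 + 2 * W.a₂ * x₁ + W.a₄ - W.a₁ * y₁) hD
    set l := (3 * x₁ ^ 2 + 2 * W.a₂ * x₁ + W.a₄ - W.a₁ * y₁) / (y₁ - W.negY x₁ y₁)
    refine mul_left_cancel₀ hD ?_
    rw [negY] at hl ⊢
    rw [hy₁, hx₁] at hl ⊢
    linear_combination (- 2 * u₁ ^ 2 * u₂ - 2 * u₁ ^ 2 * u₃ - 2 * u₁ * u₂ ^ 2 - 4 * u₁ * u₂ * u₃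
      - 2 * u₁ * u₃ ^ 2 - 2 * u₂ ^ 2 * u₃ - 2 * u₂ * u₃ ^ 2) * hy₀
      + ((1 / 2 : F) * u₁ ^ 2 * u₂ ^ 2 + u₁ ^ 2 * u₂ * u₃ + (1 / 2 : F) * u₁ ^ 2 * u₃ ^ 2
      + u₁ * u₂ ^ 2 * u₃ + u₁ * u₂ * u₃ ^ 2 + (1 / 2 : F) * u₂ ^ 2 * u₃ ^ 2
      + (1 / 2 : F) * x₀ * u₁ * u₂ + (1 / 2 : F) * x₀ * u₁ * u₃ + (1 / 2 : F) * x₀ * u₂ * u₃) * hb2'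
      + ((1 / 2 : F) * u₁ * u₂ + (1 / 2 : F) * u₁ * u₃ + (1 / 2 : F) * u₂ * u₃) * hb4'
      - (x₀ - (x₀ + u₁ * u₂ + u₁ * u₃ + u₂ * u₃)) * hl
  simp only [some.injEq]
  exact ⟨hX, hY⟩

omit [DecidableEq F] [W.IsElliptic] in
/-- On the curve, `(y + (a₁x + a₃)/2)² = (x - e₁)(x - e₂)(x - e₃)`. [folklore] -/
lemma sq_eq_mul_mul_of_equation (h : W.SplitTwoTorsion e₁ e₂ e₃) {x y : F}
    (hxy : W.Equation x y) :
    (y + (W.a₁ * x + W.a₃) / 2) ^ 2 = (x - e₁) * (x - e₂) * (x - e₃) := by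
  have hb2 := h.a₂_eq
  have hb4 := h.a₄_eq
  have hb6 := h.a₆_eq
  rw [equation_iff] at hxy
  linear_combination hxy + ((1 / 4 : F) * x ^ 2) * hb2 + ((1 / 2 : F) * x) * hb4
    + ((1 / 4 : F)) * hb6

/-- **The kernel of the `2`-descent map is `2E(F)`** (Silverman AEC Prop. X.1.4, injectivity of
`E(K)/2E(K) → K(S,2) × K(S,2)`): if both components `x - e₁`, `x - e₂` of `P` are squares
(with the conventions at `T₁, T₂`), then `P = 2Q` for some `Q ∈ E(F)`.
[cite: SilvermanAEC2009, Prop. X.1.4] -/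
theorem exists_add_self_of_twoDescentComponent_eq_one (h : W.SplitTwoTorsion e₁ e₂ e₃)
    (P : W.Point) (h1 : twoDescentComponent W e₁ e₂ e₃ P = 1)
    (h2 : twoDescentComponent W e₂ e₁ e₃ P = 1) : ∃ Q : W.Point, Q + Q = P := by
  rcases P with _ | ⟨x₀, y₀, h₀⟩
  · exact ⟨0, by rw [← zero_def, add_zero]⟩
  have hyT : ∀ e : F, W.twoTorsionY e + (W.a₁ * e + W.a₃) / 2 = 0 := fun e => by
    rw [twoTorsionY]; ring
  by_cases hx₁ : x₀ = e₁
  · subst hx₁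
    obtain rfl := eq_twoTorsionY_of_eq h h₀
    rw [twoDescentComponent_some_of_eq _ rfl, sqClass_eq_one_iff h.c_ne_zero] at h1
    rw [twoDescentComponent_some_of_ne _ h.ne₁₂, sqClass_eq_one_iff (sub_ne_zero.mpr h.ne₁₂)]
      at h2
    obtain ⟨w, hw⟩ := h1
    obtain ⟨u₂, hu₂⟩ := h2
    have hu₂0 : u₂ ≠ 0 := by
      rintro rfl
      exact h.ne₁₂ (sub_eq_zero.mp (by rw [hu₂]; ring))
    refine exists_add_self_eq h h₀ (u₁ := 0) (u₂ := u₂) (u₃ := w / u₂) (by ring) hu₂ ?_ ?_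
    · field_simp
      rw [← hw, hu₂]
      ring
    · rw [hyT]; ring
  by_cases hx₂ : x₀ = e₂
  · subst hx₂
    obtain rfl := eq_twoTorsionY_of_eq h.swap₁₂ h₀
    rw [twoDescentComponent_some_of_eq _ rfl, sqClass_eq_one_iff h.swap₁₂.c_ne_zero] at h2
    rw [twoDescentComponent_some_of_ne _ hx₁, sqClass_eq_one_iff (sub_ne_zero.mpr hx₁)] at h1
    obtain ⟨w, hw⟩ := h2
    obtain ⟨u₁, hu₁⟩ := h1
    have hu₁0 : u₁ ≠ 0 := by
      rintro rfl
      exact hx₁ (sub_eq_zero.mp (by rw [hu₁]; ring))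
    refine exists_add_self_eq h h₀ (u₁ := u₁) (u₂ := 0) (u₃ := w / u₁) hu₁ (by ring) ?_ ?_
    · field_simp
      rw [← hw, hu₁]
      ring
    · rw [hyT]; ring
  rw [twoDescentComponent_some_of_ne _ hx₁, sqClass_eq_one_iff (sub_ne_zero.mpr hx₁)] at h1
  rw [twoDescentComponent_some_of_ne _ hx₂, sqClass_eq_one_iff (sub_ne_zero.mpr hx₂)] at h2
  obtain ⟨u₁, hu₁⟩ := h1
  obtain ⟨u₂, hu₂⟩ := h2
  have hu₁0 : u₁ ≠ 0 := by rintro rfl; exact hx₁ (sub_eq_zero.mp (by rw [hu₁]; ring))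
  have hu₂0 : u₂ ≠ 0 := by rintro rfl; exact hx₂ (sub_eq_zero.mp (by rw [hu₂]; ring))
  have hE := sq_eq_mul_mul_of_equation h h₀.1
  refine exists_add_self_eq h h₀ (u₁ := u₁) (u₂ := u₂)
    (u₃ := (y₀ + (W.a₁ * x₀ + W.a₃) / 2) / (u₁ * u₂)) hu₁ hu₂ ?_ ?_
  · rw [div_pow, eq_div_iff (pow_ne_zero 2 (mul_ne_zero hu₁0 hu₂0))]
    linear_combination -hE - (x₀ - e₃) * (x₀ - e₂) * hu₁ - (x₀ - e₃) * u₁ ^ 2 * hu₂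
  · field_simp

/-! ### The `2`-descent map and `E(F)/2E(F)` -/

/-- **The complete `2`-descent map** `E(F) → Fˣ/(Fˣ)² × Fˣ/(Fˣ)²`,
`P ↦ (x(P) - e₁, x(P) - e₂)` (with the usual conventions at `O, T₁, T₂`), as a homomorphism
of groups (Silverman AEC Prop. X.1.4). [cite: SilvermanAEC2009, Prop. X.1.4] -/
def twoDescentMap (h : W.SplitTwoTorsion e₁ e₂ e₃) :
    W.Point →+ Additive (SqUnits F × SqUnits F) where
  toFun P := Additive.ofMul
    (twoDescentComponent W e₁ e₂ e₃ P, twoDescentComponent W e₂ e₁ e₃ P)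
  map_zero' := rfl
  map_add' P Q := by
    rw [twoDescentComponent_add h, twoDescentComponent_add h.swap₁₂, ← ofMul_mul, Prod.mk_mul_mk]

/-- The `2`-descent map is `(δ₁, δ₂)`. [cite: SilvermanAEC2009, Prop. X.1.4] -/
lemma twoDescentMap_apply (h : W.SplitTwoTorsion e₁ e₂ e₃) (P : W.Point) :
    twoDescentMap h P = Additive.ofMul
      (twoDescentComponent W e₁ e₂ e₃ P, twoDescentComponent W e₂ e₁ e₃ P) := rfl

/-- **The kernel of the complete `2`-descent map is exactly `2E(F)`**
(Silverman AEC Prop. X.1.4). [cite: SilvermanAEC2009, Prop. X.1.4] -/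
theorem ker_twoDescentMap (h : W.SplitTwoTorsion e₁ e₂ e₃) :
    (twoDescentMap h).ker = (nsmulAddMonoidHom 2 : W.Point →+ W.Point).range := by
  ext P
  rw [AddMonoidHom.mem_ker, AddMonoidHom.mem_range, twoDescentMap_apply]
  constructor
  · intro hP
    rw [ofMul_eq_zero, Prod.mk_eq_one] at hP
    obtain ⟨Q, hQ⟩ := exists_add_self_of_twoDescentComponent_eq_one h P hP.1 hP.2
    exact ⟨Q, by rw [nsmulAddMonoidHom_apply, two_nsmul, hQ]⟩
  · rintro ⟨Q, rfl⟩
    rw [nsmulAddMonoidHom_apply, two_nsmul, twoDescentComponent_add h,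
      twoDescentComponent_add h.swap₁₂, SqUnits.mul_self, SqUnits.mul_self]
    rfl

/-- **`E(F)/2E(F)` embeds into `Fˣ/(Fˣ)² × Fˣ/(Fˣ)²`** via the `2`-descent map; in particular
`E(F)/2E(F)` is finite as soon as the `2`-descent map takes finitely many values
(Silverman AEC Prop. X.1.4 with Thm. VIII.1.1). [cite: SilvermanAEC2009, Prop. X.1.4] -/
theorem finite_quotient_two_of_finite_range (h : W.SplitTwoTorsion e₁ e₂ e₃)
    (hfin : (Set.range (twoDescentMap h)).Finite) :
    Finite (W.Point ⧸ (nsmulAddMonoidHom 2 : W.Point →+ W.Point).range) := by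
  rw [← ker_twoDescentMap h]
  set f := QuotientAddGroup.kerLift (H := Additive (SqUnits F × SqUnits F)) (twoDescentMap h)
  have hf : Function.Injective f := QuotientAddGroup.kerLift_injective _
  have hsub : Set.range f ⊆ Set.range (twoDescentMap h) := by
    rintro _ ⟨q, rfl⟩
    induction q using QuotientAddGroup.induction_on with
    | H P => exact ⟨P, rfl⟩
  haveI : Finite (Set.range f) := (hfin.subset hsub).to_subtype
  exact Finite.of_injective (Set.rangeFactorization f) (Set.rangeFactorization_injective.mpr hf)

/-- `E(F)/2E(F)` is finite as soon as both components of the `2`-descent map take values in a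
finite subset of `Fˣ/(Fˣ)²` (the form in which the weak Mordell–Weil theorem is deduced:
values in the finite group `K(S, 2)`, Silverman AEC Prop. X.1.4 / Thm. VIII.1.1).
[cite: SilvermanAEC2009, Prop. X.1.4] -/
theorem finite_quotient_two_of_subset (h : W.SplitTwoTorsion e₁ e₂ e₃) {T : Set (SqUnits F)}
    (hT : T.Finite) (h₁ : ∀ P, twoDescentComponent W e₁ e₂ e₃ P ∈ T)
    (h₂ : ∀ P, twoDescentComponent W e₂ e₁ e₃ P ∈ T) :
    Finite (W.Point ⧸ (nsmulAddMonoidHom 2 : W.Point →+ W.Point).range) := by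
  refine finite_quotient_two_of_finite_range h (((hT.prod hT).image Additive.ofMul).subset ?_)
  rintro _ ⟨P, rfl⟩
  exact ⟨_, Set.mk_mem_prod (h₁ P) (h₂ P), rfl⟩

end Point

end WeierstrassCurve.Affine

end
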